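import Summits.NavierStokesRegularity.NavierStokesRegularity.Theses.AxisymmetricExtremality
import Summits.NavierStokesRegularity.NavierStokesRegularity.Theorems.AxisymmetricExtremalityAxisymmetricKatoGlobalReduction
import Summits.NavierStokesRegularity.NavierStokesRegularity.Theorems.AxisymmetricExtremalityAxisymmetricKatoGlobalStubSereginLogSwirlOrigin
import Summits.NavierStokesRegularity.NavierStokesRegularity.Theorems.AxisymmetricExtremalityAxisymmetricKatoGlobalNoSwirlStratum
import Literature.Analysis.FluidPDE.AxisymmetricReflection
import HarnessLib

/-!
# Strategist s19-g7 (family `s`, gen 7, independent census) — typed certificates for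
`STRATEGY-CENSUS-s19.md` on the crux `AxisymmetricKatoGlobal` (stmt-NavierStokesRegularity-15453).

Everything here is sorry-free and only DOCUMENTS the census claims:

* §H1  the weakest intermediate the route's `closes` consumes (`NoAxisymMinimalDatum`, "W0"):
  `closes_of_noAxisymMinimalDatum`, `noAxisymMinimalDatum_of_crux`;
* §H1b the O(2) / no-swirl drop-in is already a THEOREM (`crux_O2_stratum`), and the bypass route it
  suggests (`MinimalDatumO2`) is equivalent to the summit (`minimalDatumO2_iff_summit`);
* §EQ  crux ≡ a-priori log³ axis modulus of the swirl (both facts of the landed reduction discharged):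
  `crux_iff_logSwirlModulus`;
* §H2  the best both-open typed split (ε-criterion ∧ ε-evacuation) with its assembly PROVED:
  `crux_of_smallSwirl_split`.
-/

noncomputable section

open Set MeasureTheory Filter Topology Function Metric
open scoped ENNReal NNReal
open Literature.Analysis.FluidPDE Literature.Analysis.FunctionSpaces

namespace Summit.NavierStokesRegularity.NavierStokesRegularity.Cruxes.AxisymmetricKatoGlobal.StrategistS19g7

open Summit.NavierStokesRegularity.NavierStokesRegularity.Theses.AxisymmetricExtremality
open Summit.NavierStokesRegularity.NavierStokesRegularity.Theorems.AxisymmetricKatoGlobal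

local notation "ℝ³" => EuclideanSpace ℝ (Fin 3)
local notation "ℂ³" => EuclideanSpace ℂ (Fin 3)

/-! ## §H1 — weakest intermediate from the summit side -/

/-- W0: there is no axisymmetric Rusin–Šverák minimal blow-up datum (the only instance of the crux
that `closes` consumes). -/
def NoAxisymMinimalDatum : Prop :=
  ∀ ν : ℝ, 0 < ν → ∀ (u₀ : ℝ³ → ℝ³) (g : HomSobolev ℝ³ ℂ³ (1 / 2 : ℝ)),
    IsMinimalBlowupDatum ν u₀ g → IsAxisymmetric u₀ → False

/-- W0 is a drop-in replacement for the crux in the route's deciding theorem (same proof as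
`Theses.AxisymmetricExtremality.closes`). -/
theorem closes_of_noAxisymMinimalDatum (h₂ : MinimalDatumPFold) (h₄ : PFoldToAxisymmetric)
    (h₃ : NoAxisymMinimalDatum) : NavierStokesRegularity := by
  show Literature.NS.NavierStokesExistenceSmoothR3
  intro ν hν u₀ hsm hdiv hdec
  by_contra hno
  obtain ⟨u₁, g, hmin, hax⟩ := h₄ ν hν (h₂ ν hν ⟨u₀, hsm, hdiv, hdec, hno⟩)
  exact h₃ ν hν u₁ g hmin (fun θ x => hax θ x)

/-- The crux implies W0 (W0 is its threshold instance). -/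
theorem noAxisymMinimalDatum_of_crux (h : AxisymmetricKatoGlobal) : NoAxisymMinimalDatum := by
  intro ν hν u₀ g hmin hax
  obtain ⟨hL3, hrep, hdiv, -, hnot⟩ := hmin
  exact hnot (h ν hν u₀ g hL3 hrep hdiv (fun θ x => hax θ x))

/-! ## §H1b — the O(2) (meridian-reflection) stratum is a theorem; the bypass is the summit -/

/-- The crux restricted to data that are ALSO equivariant under the meridian reflection `reflY`
(i.e. O(2)-symmetric, hence swirl-free) HOLDS — landed no-swirl stratum + reflection lemma. -/
theorem crux_O2_stratum :
    ∀ ν : ℝ, 0 < ν → ∀ (u₀ : ℝ³ → ℝ³) (g : HomSobolev ℝ³ ℂ³ (1 / 2 : ℝ)),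
      MemLp u₀ 3 volume →
      g.Represents (Literature.Analysis.FunctionSpaces.EuclideanSpace.complexify ∘ u₀) →
      IsWeaklyDivFree u₀ → IsAxisymmetric u₀ → (∀ x, reflY (u₀ (reflY.symm x)) = u₀ x) →
      HasGlobalKatoSolution ν u₀ := by
  intro ν hν u₀ g hL3 _ hdiv hax hrefl
  exact NoSwirlStratum.axisymmetricKatoGlobal_noSwirl_stratum ν hν u₀ hL3 hdiv (fun θ x => hax θ x)
    (hax.hasNoSwirl_of_conj_reflY_eq hrefl)

/-- Clay failure at viscosity ν (the antecedent of `MinimalDatumPFold`, copied verbatim). -/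
def ClayFails (ν : ℝ) : Prop :=
  ∃ v₀ : ℝ³ → ℝ³, ContDiff ℝ (⊤ : ℕ∞) v₀ ∧ Literature.Analysis.FluidPDE.NSWave0.IsDivFree v₀ ∧
    Literature.Analysis.FluidPDE.HasRapidSpatialDecay v₀ ∧
    ¬ ∃ (u : ℝ → ℝ³ → ℝ³) (p : ℝ → ℝ³ → ℝ),
      Literature.Analysis.FluidPDE.IsSmoothOnHalfSpace u ∧ Literature.Analysis.FluidPDE.IsSmoothOnHalfSpace p ∧
      Literature.Analysis.FluidPDE.IsNavierStokesSolution ν 0 v₀ u p ∧ Literature.Analysis.FluidPDE.HasBoundedEnergy u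

/-- The "dihedral/O(2) bypass": Clay failure produces an O(2)-symmetric minimal blow-up datum
(what a Smith step for dihedral 2-groups + closure ∪ D_{2^k} = O(2) would give). -/
def MinimalDatumO2 : Prop :=
  ∀ ν : ℝ, 0 < ν → ClayFails ν → ∃ (u₀ : ℝ³ → ℝ³) (g : HomSobolev ℝ³ ℂ³ (1 / 2 : ℝ)),
    IsMinimalBlowupDatum ν u₀ g ∧ IsAxisymmetric u₀ ∧ ∀ x, reflY (u₀ (reflY.symm x)) = u₀ x

/-- With the O(2) bypass the route would close with NO analytic crux … -/
theorem closes_of_minimalDatumO2 (h : MinimalDatumO2) : NavierStokesRegularity := by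
  show Literature.NS.NavierStokesExistenceSmoothR3
  intro ν hν u₀ hsm hdiv hdec
  by_contra hno
  obtain ⟨u₁, g, hmin, hax, hrefl⟩ := h ν hν ⟨u₀, hsm, hdiv, hdec, hno⟩
  obtain ⟨hL3, hrep, hdiv₁, -, hnot⟩ := hmin
  exact hnot (crux_O2_stratum ν hν u₁ g hL3 hrep hdiv₁ hax hrefl)

/-- … but the bypass statement is EQUIVALENT to the summit (its antecedent is Clay failure), so it
relocates the summit instead of cutting it. -/
theorem minimalDatumO2_iff_summit : MinimalDatumO2 ↔ NavierStokesRegularity := by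
  refine ⟨closes_of_minimalDatumO2, fun hS => ?_⟩
  intro ν hν hfail
  obtain ⟨v₀, hsm, hdiv, hdec, hno⟩ := hfail
  have hS' : Literature.NS.NavierStokesExistenceSmoothR3 := hS
  exact absurd (hS' ν hν v₀ hsm hdiv hdec) hno

/-! ## §EQ — the crux IS the a-priori log³ axis modulus (machine-checked, both facts discharged) -/

/-- The a-priori logarithmic axis modulus of the swirl up to the Kato time (hypothesis 2 of the
landed reduction `Registered.AxisymmetricKatoGlobal_of_logSwirlFacts`). -/
def LogSwirlModulus : Prop :=
  ∀ ν : ℝ, 0 < ν → ∀ T : ℝ, 0 < T → ∀ (u₀ : ℝ³ → ℝ³) (g : HomSobolev ℝ³ ℂ³ (1 / 2 : ℝ))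
    (u : ℝ → ℝ³ → ℝ³), g.Represents (Literature.Analysis.FunctionSpaces.EuclideanSpace.complexify ∘ u₀) →
    IsKatoSolutionOn T ν u₀ u → ContDiffOn ℝ (⊤ : ℕ∞) (uncurry u) (Ioo 0 T ×ˢ univ) →
    (∀ t ∈ Ioo 0 T, IsAxisymmetric (u t)) →
    ∀ t₀ ∈ Ioo 0 T, ∃ C δ₀ : ℝ, 0 < δ₀ ∧ δ₀ < 1 ∧ ∀ t ∈ Ico t₀ T, ∀ x : ℝ³,
      cylRadius x ≤ δ₀ → |swirl (u t) x| ≤ C / |Real.log (cylRadius x)| ^ 3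

/-- log³ modulus ⇒ crux, with the Seregin (2022) ε-regularity fact now DISCHARGED in the tree. -/
theorem crux_of_logSwirlModulus (h : LogSwirlModulus) : AxisymmetricKatoGlobal :=
  Registered.AxisymmetricKatoGlobal_of_logSwirlFacts EulerScaling.seregin2022_logSwirl_regularAtOrigin_holds h

/-! ## §H2 — the best both-open typed split: ε-criterion ∧ ε-evacuation (assembly proved) -/

/-- P1 (log-free small-swirl ε-regularity, OPEN — Lei–Zhang's "criticality" question): some absolute
ε > 0 such that a smooth axisymmetric Kato solution on (0,T) whose swirl satisfies |Γ| ≤ ε ν near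
the axis from some time on is bounded near every point of the time-T slice. -/
def SmallSwirlCriterion : Prop :=
  ∃ ε : ℝ, 0 < ε ∧ ∀ ν : ℝ, 0 < ν → ∀ T : ℝ, 0 < T → ∀ (u₀ : ℝ³ → ℝ³) (u : ℝ → ℝ³ → ℝ³),
    MemLp u₀ 3 volume → IsWeaklyDivFree u₀ → IsKatoSolutionOn T ν u₀ u →
    ContDiffOn ℝ (⊤ : ℕ∞) (uncurry u) (Ioo 0 T ×ˢ univ) → (∀ t ∈ Ioo 0 T, IsAxisymmetric (u t)) →
    (∃ t₀ ∈ Ioo 0 T, ∃ δ₀ : ℝ, 0 < δ₀ ∧ ∀ t ∈ Ico t₀ T, ∀ x : ℝ³,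
      cylRadius x ≤ δ₀ → |swirl (u t) x| ≤ ε * ν) →
    ∀ xs : ℝ³, ∃ r : ℝ, 0 < r ∧
      eLpNorm (uncurry u) ∞ (volume.restrict (parabolicCylinder r (T, xs))) < ∞

/-- P2 (swirl evacuates the axis, OPEN — the negation of the Hou–Luo/Hou 2022 tornado scenario): for
every ε the swirl of a smooth axisymmetric Kato solution is ≤ ε ν on a time-uniform neighbourhood of
the axis up to the Kato time. -/
def SwirlEvacuatesAxis : Prop :=
  ∀ ε : ℝ, 0 < ε → ∀ ν : ℝ, 0 < ν → ∀ T : ℝ, 0 < T → ∀ (u₀ : ℝ³ → ℝ³) (u : ℝ → ℝ³ → ℝ³),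
    MemLp u₀ 3 volume → IsWeaklyDivFree u₀ → IsKatoSolutionOn T ν u₀ u →
    ContDiffOn ℝ (⊤ : ℕ∞) (uncurry u) (Ioo 0 T ×ˢ univ) → (∀ t ∈ Ioo 0 T, IsAxisymmetric (u t)) →
    ∀ t₀ ∈ Ioo 0 T, ∃ δ₀ : ℝ, 0 < δ₀ ∧ ∀ t ∈ Ico t₀ T, ∀ x : ℝ³,
      cylRadius x ≤ δ₀ → |swirl (u t) x| ≤ ε * ν

/-- Assembly of the split, PROVED (shape of the landed capstone; stub 1 `stub_katoAxisymSingularPoint`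
is landed): P1 → P2 → crux. -/
theorem crux_of_smallSwirl_split (h₁ : SmallSwirlCriterion) (h₂ : SwirlEvacuatesAxis) :
    AxisymmetricKatoGlobal := by
  intro ν hν u₀ g hL3 _hrep hdiv hax
  have hax' : IsAxisymmetric u₀ := fun θ x => hax θ x
  by_contra hng
  obtain ⟨T, hT, xs, u, hK, hsm, haxi, hsing⟩ :=
    Registered.stub_katoAxisymSingularPoint ν hν u₀ hL3 hdiv hax' hng
  obtain ⟨ε, hε, hcrit⟩ := h₁
  have ht₀ : T / 2 ∈ Ioo 0 T := ⟨by linarith, by linarith⟩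
  obtain ⟨δ₀, hδ₀, hmod⟩ := h₂ ε hε ν hν T hT u₀ u hL3 hdiv hK hsm haxi (T / 2) ht₀
  obtain ⟨r, hr, hfin⟩ := hcrit ν hν T hT u₀ u hL3 hdiv hK hsm haxi ⟨T / 2, ht₀, δ₀, hδ₀, hmod⟩ xs
  exact absurd (hsing r hr) hfin.ne

end Summit.NavierStokesRegularity.NavierStokesRegularity.Cruxes.AxisymmetricKatoGlobal.StrategistS19g7

end
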